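import Summits.KontsevichZagierPeriods.KontsevichZagierPeriods.Theses.UnfoldedStokes
import Literature.NumberTheory.Transcendental.KZSemialgebraicComplex
import Summits.KontsevichZagierPeriods.KontsevichZagierPeriods.Theorems.GpcLegendreLemniscatic.Negative.Strengthenings
import Summits.KontsevichZagierPeriods.KontsevichZagierPeriods.Theorems.GpcLegendreLemniscatic.Negative.LoadBearing
import Summits.KontsevichZagierPeriods.KontsevichZagierPeriods.Theorems.GpcLegendreLemniscatic.Negative.DomainEuler
import Literature.Analysis.SpecialFunctions.LegendreRelation
import Literature.NumberTheory.Transcendental.SemialgebraicAlgebraicPoints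

/-!
# Disproof of `LegendreAllModuli` (stmt-KontsevichZagierPeriods-3523) — standing adversary, cycle 1

Crux (route UnfoldedStokes, rank 5; line `Sketch` picked): for every real-algebraic `k ∈ (0,1)`,
every `r : IntegralRep 2` with domain `(0,1)²` and integrand
`e_k(x₀)κ_{k′}(x₁) + e_{k′}(x₀)κ_k(x₁) − κ_k(x₀)κ_{k′}(x₁)` (`κ_m(t) = ((1−t²)(1−mt²))^{-1/2}`,
`e_m(t) = (1−mt²)^{1/2}(1−t²)^{-1/2}`, parameters `m = k²`, `k′² = 1 − k²`; value
`E K′ + E′ K − K K′`) and every `r' : IntegralRep 1` with domain `ℝ` and integrand `1/(2(1+x²))`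
(value `π/2`) are `KZ.Equivalent` — Legendre's relation at every algebraic modulus INSIDE the
four-move Kontsevich–Zagier calculus.

**Verdict of cycle 1: the crux RESISTS every cheap attack; no kill is possible short of disproving
the summit; the picked line `Sketch` is sound and two of its five stubs remain (M2, M3), both
certified pointwise here. Expect a PROOF, not a refutation.**
All theorems below are sorry-free; `lean check` rc 0; numerics: compute job j016517
(`num/value_check.py`, evidence on the item).

Findings (section numbers refer to this file):

1. §1 READBACK / VOCABULARY / NON-VACUITY. `legendreAllModuli_iff : crux ↔ ∀ k, IsAlgebraic ℚ k →
   0 < k → k < 1 → LegendreAllModuliAt k` (definitional). The printed integrand, read with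
   left-associated divisions, is the three-product combination
   `e_{k²} ⊗ κ_{1−k²} + e_{1−k²} ⊗ κ_{k²} − κ_{k²} ⊗ κ_{1−k²}` (`cruxIntegrandAt_eq`, a ring identity).
   The canonical representation `legendreRepAt k` (integrand VERBATIM the crux's) is constructed at
   every real-algebraic `k ∈ (0,1)` from three Fubini products of unit-interval representations
   (semialgebraicity with the algebraic parameter via `isSemialgebraicFunOn_const_of_isAlgebraic`,
   integrability via `intervalIntegrable_ellIntegrand`): the hypotheses are SATISFIABLE at every
   modulus, the `∀ r r'` shape adds nothing (`legendreAllModuliAt_iff_canonical`).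
2. §2 NO EVALUATION KILL AT ANY MODULUS: `legendreRepAt_value : value = π/2` (Fubini ×3 + the tree
   THEOREM `Lawden1989_eq_3_8_29_holds`, Legendre's relation for all `0 < k < 1`,
   `Literature/Analysis/SpecialFunctions/LegendreRelation.lean`), `values_of_admissible`. THE KILL
   CRITERION, FORMAL: `not_kontsevichZagierPeriods_of_not_legendreAllModuli : ¬crux → ¬summit`
   (`exists_isRational_equivalent_holds` + soundness + the value identity) — the only conceivable
   weapon is a new additive invariant of the full calculus separating equal-valued representations.
   The lemniscatic instance: `gpcLegendreLemniscatic_of_legendreAllModuli : crux → GpcLegendreLemniscatic`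
   (stmt-0280), so the sibling disproof file's resistance analysis (Chudnovsky: no termwise transfer;
   CM point analysis) is inherited, and a kill of 0280 would be needed first — 0280 resists.
3. §3 NECESSARY MOVES AT EVERY MODULUS (sub-calculus invariants of the sibling's landed Negative
   files, instantiated uniformly in `k`): `not_mem_closure_without_newtonLeibniz_at` (rules 1a,1b,2
   do not suffice: `eval ∘ dimProj 2` sees `π/2 ≠ 0`), `not_mem_closure_newtonLeibniz_of_domains`
   (rule 3 alone does not suffice, unconditionally: `E((0,1)²) − E(ℝ) = 2`),
   `not_mem_closure_without_additivity_of_domains` (rules 2+3 do not suffice, modulo van den Dries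
   Ch. 4 (2.4)). The picked line uses rule (3) once (M4) and rule (1) in M1/M4/M5 — consistent.
4. §4 THE SCALAR HYPOTHESES ARE NOT LOAD-BEARING — no `_false_without_` theorem exists for them:
   sign symmetry (`legendreAllModuliAt_neg_iff`); at `k = 0` the integrand collapses on `(0,1)²` to
   `1/√(1−x₁²)` and the values still agree (`cruxIntegrandAt_zero_eqOn`, `values_at_zero`,
   `legendreAllModuliAt_zero_iff : LegendreAllModuliAt 0 ↔ [1]·[a] ~ arctanRep`) — the two-modulus
   shape SURVIVES the nodal limit, unlike the sibling's single-modulus `LegendreShape 0` (false by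
   value); `k = ±1` is VACUOUS — PROVED: `not_integrableOn_cruxIntegrandAt_one` (the second term
   `1/(√(1−x₀²)(1−x₁²))` is not integrable; Fubini + `∫₀¹dy/(1−y²) = ∞`), `legendreAllModuliAt_one :
   LegendreAllModuliAt 1`; `|k| > 1` keeps the
   value `π/2` under Mathlib's junk conventions (reciprocal-modulus transformation; numerics j016517,
   `2·10⁻¹⁶`); `IsAlgebraic ℚ k` is REDUNDANT — PROVED: `isAlgebraic_of_admissible` (a
   `ℚ`-semialgebraic integrand evaluated at the rational point `(½,½)` is algebraic, tree theorem
   `IsSemialgebraicFunOn.isAlgebraic_apply`, and the value `1/√((1−k²/4)(¾+k²/4))` pins `k`),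
   `legendreAllModuli_iff_forall_Ioo : crux ↔ ∀ k, 0 < k → k < 1 → LegendreAllModuliAt k`,
   `legendreAllModuliAt_of_transcendental` (vacuous). For the provers: nothing in a proof may USE
   `0 < k < 1` beyond integrability of the separate factors.
5. §5 LINE `Sketch` AUDIT (the lead's five stubs): none false, none mis-stated, composition
   `LegendreAllModuli_of` closes from them (rc 0). M1, M4, M5 are LANDED by provers
   (`Theorems/UnfoldedStokesLegendreAllModuliStub{Symmetrise,StripNewtonLeibniz,HalfLineTail}.lean`).
   The two open stubs are certified pointwise in the lead's VERBATIM shapes: M2 — `octant_pointwise`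
   (`F_m = (1 − X² − Z²)^{-1/2}|det DΦ_m|` for ALL `0 ≤ m ≤ 1`), `one_sub_normSq_spheroConal`,
   `spheroConalDet_pos`, `spheroConal_mem_quarterDisc`; M3 — `strip_pointwise`. Numerics: M1/M2/M3
   identities to `10⁻³⁰`, `Φ_m` has a unique preimage in the open square (bijectivity; kernel-checked
   as `spheroConal_bijOn` in `Cruxes/GpcLegendreLemniscatic/SketchIdeator2g2.lean`).
6. REFUTED STRENGTHENINGS: nothing new beyond the sibling file (inherited via finding 2): termwise
   transfer is refuted at `k² = ½` by Chudnovsky; the single-modulus shape is false off the CM point.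
   The natural all-moduli strengthenings (drop `IsAlgebraic`; allow `k = 0` or `|k| > 1`; dimension
   budget `≤ 2`) are all TRUE or vacuous (finding 4; the line stays in dimension ≤ 2).
7. Targets: none handed over (`stuck_stubs = []`). Near-misses: none (no kill line exists, §2).
-/

noncomputable section

set_option linter.dupNamespace false

open MeasureTheory Set
open Literature.NumberTheory.Transcendental
open Literature.NumberTheory.Transcendental.KZ
open Literature.ModelTheory.ExponentialFields (IsSemialgebraic)
open Literature.Probability.RandomPlanarGeometry (ellIntegrand intervalIntegrable_ellIntegrand)
open Literature.Analysis.SpecialFunctions (completeEllipticK completeEllipticE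
  Lawden1989_eq_3_8_29_holds)
open MvPolynomial (aeval X C)
open Summit.KontsevichZagierPeriods.KontsevichZagierPeriods.Theses.UnfoldedStokes
  (LegendreAllModuli LegendreLemniscatic LegendreGlue)
open Summit.KontsevichZagierPeriods.KontsevichZagierPeriods.Theses.Grothendieck (GpcLegendreLemniscatic)
open Summit.KontsevichZagierPeriods.Grothendieck.GpcLegendreLemniscaticNegative

namespace Summit.KontsevichZagierPeriods.KontsevichZagierPeriods.Cruxes.LegendreAllModuli.Disproof

/-! ## §1 Readback and vocabulary -/

/-! ### One-dimensional densities (re-derived here verbatim from the landed stub file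
`Theorems/UnfoldedStokesLegendreAllModuliStubSymmetrise.lean`, namespace `…LegendreAllModuliLine.M1`,
so that this work file does not depend on the farm having built that module) -/

section Densities

variable {m : ℝ}

/-- On `(0,1)`, `1 − t² > 0`. [folklore] -/
theorem one_sub_sq_pos {t : ℝ} (ht : t ∈ Ioo (0:ℝ) 1) : 0 < 1 - t ^ 2 := by
  nlinarith [ht.1, ht.2]

/-- On `(0,1)`, `1 − m t² > 0` whenever `m < 1`. [folklore] -/
theorem lin_pos (hm1 : m < 1) {t : ℝ} (ht : t ∈ Ioo (0:ℝ) 1) : 0 < 1 - m * t ^ 2 := by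
  have h1 : 0 < 1 - t ^ 2 := one_sub_sq_pos ht
  nlinarith [mul_nonneg (sub_pos.2 hm1).le (sq_nonneg t)]

/-- `x ↦ 1 − m x₀²` is `ℚ`-semialgebraic on `unitIoo` for real-algebraic `m`. [folklore] -/
theorem isSemialgebraicFunOn_lin (hm : IsAlgebraic ℚ m) :
    IsSemialgebraicFunOn ℚ unitIoo (fun x => 1 - m * x 0 ^ 2) := by
  have hc := isSemialgebraicFunOn_const_of_isAlgebraic isSemialgebraic_unitIoo hm
  have hsq := isSemialgebraicFunOn_aeval isSemialgebraic_unitIoo (X 0 ^ 2 : MvPolynomial (Fin 1) ℚ)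
  have h1 := isSemialgebraicFunOn_ratCast isSemialgebraic_unitIoo 1
  have h := IsSemialgebraicFunOn.sub_holds h1 (IsSemialgebraicFunOn.mul_holds hc hsq)
  refine h.congr fun x _ => ?_
  simp

/-- `x ↦ κ_m(x₀)` is `ℚ`-semialgebraic on `unitIoo` (`m` real-algebraic, `m < 1`). [folklore] -/
theorem isSemialgebraicFunOn_kap (hm : IsAlgebraic ℚ m) (hm1 : m < 1) :
    IsSemialgebraicFunOn ℚ unitIoo (fun x => ellIntegrand m (x 0)) := by
  have hp := IsSemialgebraicFunOn.mul_holds isSemialgebraicFunOn_one_sub_sq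
    (isSemialgebraicFunOn_lin hm)
  have hsqrt := IsSemialgebraicFunOn.sqrt_holds hp
  have h1 := isSemialgebraicFunOn_ratCast isSemialgebraic_unitIoo 1
  refine ((h1.div hsqrt) fun x hx => ?_).congr fun x _ => ?_
  · exact (Real.sqrt_pos.2 (mul_pos (one_sub_sq_pos hx) (lin_pos hm1 hx))).ne'
  · simp [ellIntegrand]

/-- `x ↦ e_m(x₀) = √(1 − m x₀²)/√(1 − x₀²)` is `ℚ`-semialgebraic on `unitIoo` (`m` real-algebraic).
[folklore] -/
theorem isSemialgebraicFunOn_e (hm : IsAlgebraic ℚ m) :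
    IsSemialgebraicFunOn ℚ unitIoo
      (fun x => Real.sqrt (1 - m * x 0 ^ 2) / Real.sqrt (1 - x 0 ^ 2)) := by
  have hn := IsSemialgebraicFunOn.sqrt_holds (isSemialgebraicFunOn_lin hm)
  have hd := IsSemialgebraicFunOn.sqrt_holds isSemialgebraicFunOn_one_sub_sq
  exact (hn.div hd) fun x hx => (Real.sqrt_pos.2 (one_sub_sq_pos hx)).ne'

/-- `κ_m` is integrable on `(0,1)` for `0 ≤ m < 1`. [folklore] -/
theorem integrableOn_kap (hm0 : 0 ≤ m) (hm1 : m < 1) : IntegrableOn (ellIntegrand m) (Ioo 0 1) := by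
  have h := intervalIntegrable_ellIntegrand hm0 hm1
  rwa [intervalIntegrable_iff_integrableOn_Ioo_of_le zero_le_one] at h

/-- `e_m ≤ κ_0` on `(0,1)` for `0 ≤ m`, so `e_m` is integrable on `(0,1)`. [folklore] -/
theorem integrableOn_e (hm0 : 0 ≤ m) :
    IntegrableOn (fun t => Real.sqrt (1 - m * t ^ 2) / Real.sqrt (1 - t ^ 2)) (Ioo 0 1) := by
  have h := intervalIntegrable_ellIntegrand (m := 0) le_rfl (by norm_num)
  rw [intervalIntegrable_iff_integrableOn_Ioo_of_le zero_le_one] at h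
  refine h.mono' ?_ ?_
  · refine ContinuousOn.aestronglyMeasurable ?_ measurableSet_Ioo
    refine ContinuousOn.div (by fun_prop) (by fun_prop) fun t ht => ?_
    exact (Real.sqrt_pos.2 (one_sub_sq_pos ht)).ne'
  · refine (ae_restrict_mem measurableSet_Ioo).mono fun t ht => ?_
    have hs : 0 < Real.sqrt (1 - t ^ 2) := Real.sqrt_pos.2 (one_sub_sq_pos ht)
    have hnum : Real.sqrt (1 - m * t ^ 2) ≤ 1 := by
      rw [Real.sqrt_le_one]
      linarith [mul_nonneg hm0 (sq_nonneg t)]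
    rw [Real.norm_eq_abs, abs_of_nonneg (div_nonneg (Real.sqrt_nonneg _) hs.le),
      ellIntegrand, zero_mul, sub_zero, mul_one]
    exact div_le_div_of_nonneg_right hnum hs.le

end Densities

/-- The crux integrand at modulus `k`, VERBATIM (left-associated divisions as printed):
`e_k(x₀)κ_{k′}(x₁) + e_{k′}(x₀)κ_k(x₁) − κ_k(x₀)κ_{k′}(x₁)`, `k′² = 1 − k²`. [folklore] -/
def cruxIntegrandAt (k : ℝ) (x : Fin 2 → ℝ) : ℝ :=
  Real.sqrt (1 - k ^ 2 * x 0 ^ 2) / Real.sqrt (1 - x 0 ^ 2) /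
        Real.sqrt ((1 - x 1 ^ 2) * (1 - (1 - k ^ 2) * x 1 ^ 2)) +
      Real.sqrt (1 - (1 - k ^ 2) * x 0 ^ 2) / Real.sqrt (1 - x 0 ^ 2) /
        Real.sqrt ((1 - x 1 ^ 2) * (1 - k ^ 2 * x 1 ^ 2)) -
    1 / Real.sqrt ((1 - x 0 ^ 2) * (1 - k ^ 2 * x 0 ^ 2)) /
      Real.sqrt ((1 - x 1 ^ 2) * (1 - (1 - k ^ 2) * x 1 ^ 2))

/-- The crux AT ONE MODULUS `k`, with the three scalar side conditions (`IsAlgebraic ℚ k`,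
`0 < k`, `k < 1`) stripped — the unit of the load-bearing analysis of §3. [folklore] -/
def LegendreAllModuliAt (k : ℝ) : Prop :=
  ∀ (r : IntegralRep 2) (r' : IntegralRep 1), r.domain = unitSq →
    EqOn r.integrand (cruxIntegrandAt k) r.domain → r'.domain = univ →
    EqOn r'.integrand (fun x => 1 / (2 * (1 + x 0 ^ 2))) r'.domain → Equivalent r r'

/-- READBACK: the crux is `∀ k, IsAlgebraic ℚ k → 0 < k → k < 1 → LegendreAllModuliAt k`
(definitional). [folklore] -/
theorem legendreAllModuli_iff :
    LegendreAllModuli ↔ ∀ k : ℝ, IsAlgebraic ℚ k → 0 < k → k < 1 → LegendreAllModuliAt k :=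
  Iff.rfl

/-- The `E`-density `e_m(t) = √(1 − m t²)/√(1 − t²)` (parameter `m = k²`). [cite: Lawden1989, §3.8 eq. (3.8.3)] -/
def eDens (m t : ℝ) : ℝ := Real.sqrt (1 - m * t ^ 2) / Real.sqrt (1 - t ^ 2)

/-- On `(0,1)²` the crux integrand is the three-product combination
`e_{k²} ⊗ κ_{1−k²} + e_{1−k²} ⊗ κ_{k²} − κ_{k²} ⊗ κ_{1−k²}` (`κ_m = ellIntegrand m`) — in fact for
ALL `x` (pure bookkeeping of divisions). [folklore] -/
theorem cruxIntegrandAt_eq (k : ℝ) (x : Fin 2 → ℝ) :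
    cruxIntegrandAt k x =
      eDens (k ^ 2) (x 0) * ellIntegrand (1 - k ^ 2) (x 1) +
        eDens (1 - k ^ 2) (x 0) * ellIntegrand (k ^ 2) (x 1) -
      ellIntegrand (k ^ 2) (x 0) * ellIntegrand (1 - k ^ 2) (x 1) := by
  simp only [cruxIntegrandAt, eDens, ellIntegrand]
  ring

variable {k : ℝ}

/-- `k²` and `1 − k²` are real-algebraic and lie in `[0,1)` for real-algebraic `0 < k < 1`. [folklore] -/
theorem params (hk : IsAlgebraic ℚ k) (hk0 : 0 < k) (hk1 : k < 1) :
    IsAlgebraic ℚ (k ^ 2) ∧ IsAlgebraic ℚ (1 - k ^ 2) ∧ 0 ≤ k ^ 2 ∧ k ^ 2 < 1 ∧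
      0 ≤ 1 - k ^ 2 ∧ 1 - k ^ 2 < 1 := by
  refine ⟨hk.pow 2, isAlgebraic_one.sub (hk.pow 2), sq_nonneg k, by nlinarith, by nlinarith,
    by nlinarith⟩

/-- `[e_a]` as a unit-interval representation (`a` real-algebraic, `0 ≤ a`). [folklore] -/
def eRepAt (a : ℝ) (ha : IsAlgebraic ℚ a) (ha0 : 0 ≤ a) : IntegralRep 1 :=
  unitRep (eDens a) (isSemialgebraicFunOn_e ha) (integrableOn_e ha0)

/-- `[κ_a]` as a unit-interval representation (`a` real-algebraic, `0 ≤ a < 1`). [folklore] -/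
def kapRepAt (a : ℝ) (ha : IsAlgebraic ℚ a) (ha0 : 0 ≤ a) (ha1 : a < 1) : IntegralRep 1 :=
  unitRep (ellIntegrand a) (isSemialgebraicFunOn_kap ha ha1) (integrableOn_kap ha0 ha1)

/-- `value [e_{k²}] = E(k)` (the tree's `completeEllipticE`). [cite: Lawden1989, §3.8 eq. (3.8.3)] -/
theorem eRepAt_sq_value (hk : IsAlgebraic ℚ (k ^ 2)) (h0 : 0 ≤ k ^ 2) :
    (eRepAt (k ^ 2) hk h0).value = completeEllipticE k := by
  rw [eRepAt, unitRep_value]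
  rfl

/-- `value [κ_{k²}] = K(k)` (the tree's `completeEllipticK`). [cite: Zhou2013, §1 (notation K)] -/
theorem kapRepAt_sq_value (hk : IsAlgebraic ℚ (k ^ 2)) (h0 : 0 ≤ k ^ 2) (h1 : k ^ 2 < 1) :
    (kapRepAt (k ^ 2) hk h0 h1).value = completeEllipticK k := by
  rw [kapRepAt, unitRep_value]
  rfl

/-- `value [e_{1−k²}] = E(k′)`, `k′ = √(1 − k²)`. [cite: Lawden1989, §3.8 eq. (3.8.3)] -/
theorem eRepAt_compl_value (hk : IsAlgebraic ℚ (1 - k ^ 2)) (h0 : 0 ≤ 1 - k ^ 2) :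
    (eRepAt (1 - k ^ 2) hk h0).value = completeEllipticE (Real.sqrt (1 - k ^ 2)) := by
  rw [eRepAt, unitRep_value, completeEllipticE, Real.sq_sqrt h0]
  rfl

/-- `value [κ_{1−k²}] = K(k′)`, `k′ = √(1 − k²)`. [cite: Zhou2013, §1 (notation K)] -/
theorem kapRepAt_compl_value (hk : IsAlgebraic ℚ (1 - k ^ 2)) (h0 : 0 ≤ 1 - k ^ 2)
    (h1 : 1 - k ^ 2 < 1) :
    (kapRepAt (1 - k ^ 2) hk h0 h1).value = completeEllipticK (Real.sqrt (1 - k ^ 2)) := by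
  rw [kapRepAt, unitRep_value, completeEllipticK, Real.sq_sqrt h0]
  rfl

/-- **The canonical left representation at modulus `k`**: domain `(0,1)²`, integrand VERBATIM the
crux's `cruxIntegrandAt k`; semialgebraicity and absolute integrability are inherited from the three
Fubini products `[e_{k²}]·[κ_{1−k²}]`, `[e_{1−k²}]·[κ_{k²}]`, `[κ_{k²}]·[κ_{1−k²}]`. NON-VACUITY of
the crux at every real-algebraic `k ∈ (0,1)`. [folklore] -/
def legendreRepAt (k : ℝ) (hk : IsAlgebraic ℚ k) (hk0 : 0 < k) (hk1 : k < 1) : IntegralRep 2 :=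
  let P := params hk hk0 hk1
  let T1 := (eRepAt (k ^ 2) P.1 P.2.2.1).prod (kapRepAt (1 - k ^ 2) P.2.1 P.2.2.2.2.1 P.2.2.2.2.2)
  let T2 := (eRepAt (1 - k ^ 2) P.2.1 P.2.2.2.2.1).prod (kapRepAt (k ^ 2) P.1 P.2.2.1 P.2.2.2.1)
  let T3 := (kapRepAt (k ^ 2) P.1 P.2.2.1 P.2.2.2.1).prod
    (kapRepAt (1 - k ^ 2) P.2.1 P.2.2.2.2.1 P.2.2.2.2.2)
  have h1d : T1.domain = unitSq := prod_unitRep_domain _ _ _ _ _ _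
  have h2d : T2.domain = unitSq := prod_unitRep_domain _ _ _ _ _ _
  have h3d : T3.domain = unitSq := prod_unitRep_domain _ _ _ _ _ _
  have heq : EqOn (T1.integrand + T2.integrand - T3.integrand) (cruxIntegrandAt k) unitSq := by
    intro x _
    simp only [Pi.add_apply, Pi.sub_apply, T1, T2, T3, eRepAt, kapRepAt,
      prod_unitRep_integrand_apply, cruxIntegrandAt_eq]
  { domain := unitSq
    integrand := cruxIntegrandAt k
    isSemialgebraic_domain := isSemialgebraic_unitSq
    isSemialgebraicFunOn_integrand := by
      refine IsSemialgebraicFunOn.congr ?_ heq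
      exact IsSemialgebraicFunOn.sub_holds
        (IsSemialgebraicFunOn.add_holds (h1d ▸ T1.isSemialgebraicFunOn_integrand)
          (h2d ▸ T2.isSemialgebraicFunOn_integrand)) (h3d ▸ T3.isSemialgebraicFunOn_integrand)
    integrableOn := by
      refine IntegrableOn.congr_fun ?_ heq isSemialgebraic_unitSq.measurableSet_holds
      exact ((h1d ▸ T1.integrableOn).add (h2d ▸ T2.integrableOn)).sub (h3d ▸ T3.integrableOn) }

/-- The domain of `legendreRepAt k`. [folklore] -/
@[simp] theorem legendreRepAt_domain (hk : IsAlgebraic ℚ k) (hk0 : 0 < k) (hk1 : k < 1) :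
    (legendreRepAt k hk hk0 hk1).domain = unitSq := rfl

/-- The integrand of `legendreRepAt k` is the crux's, verbatim. [folklore] -/
@[simp] theorem legendreRepAt_integrand (hk : IsAlgebraic ℚ k) (hk0 : 0 < k) (hk1 : k < 1) :
    (legendreRepAt k hk hk0 hk1).integrand = cruxIntegrandAt k := rfl


/-! ## §2 Values: NO EVALUATION KILL at any modulus; reduction to the canonical pair;
## the kill criterion (a refutation of the crux refutes the summit) -/

/-- **Value of the canonical representation**: `E(k)K(k′) + E(k′)K(k) − K(k)K(k′) = π/2`
(Fubini `IntegralRep.value_prod` three times and the tree THEOREM `Lawden1989_eq_3_8_29_holds`,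
Legendre's relation for all moduli `0 < k < 1`). [cite: Lawden1989, §3.8 eq. (3.8.29)] -/
theorem legendreRepAt_value (hk : IsAlgebraic ℚ k) (hk0 : 0 < k) (hk1 : k < 1) :
    (legendreRepAt k hk hk0 hk1).value = Real.pi / 2 := by
  obtain ⟨P1, P2, P3, P4, P5, P6⟩ := params hk hk0 hk1
  set T1 := (eRepAt (k ^ 2) P1 P3).prod (kapRepAt (1 - k ^ 2) P2 P5 P6) with hT1
  set T2 := (eRepAt (1 - k ^ 2) P2 P5).prod (kapRepAt (k ^ 2) P1 P3 P4) with hT2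
  set T3 := (kapRepAt (k ^ 2) P1 P3 P4).prod (kapRepAt (1 - k ^ 2) P2 P5 P6) with hT3
  have h1d : T1.domain = unitSq := prod_unitRep_domain _ _ _ _ _ _
  have h2d : T2.domain = unitSq := prod_unitRep_domain _ _ _ _ _ _
  have h3d : T3.domain = unitSq := prod_unitRep_domain _ _ _ _ _ _
  have heq : EqOn (cruxIntegrandAt k) (fun x => T1.integrand x + T2.integrand x - T3.integrand x)
      unitSq := by
    intro x _
    simp only [hT1, hT2, hT3, eRepAt, kapRepAt, prod_unitRep_integrand_apply, cruxIntegrandAt_eq,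
      eDens]
  have hi1 : IntegrableOn T1.integrand unitSq := h1d ▸ T1.integrableOn
  have hi2 : IntegrableOn T2.integrand unitSq := h2d ▸ T2.integrableOn
  have hi3 : IntegrableOn T3.integrand unitSq := h3d ▸ T3.integrableOn
  have e1 : ∫ x in unitSq, (T1.integrand x + T2.integrand x - T3.integrand x) =
      (∫ x in unitSq, (T1.integrand x + T2.integrand x)) - ∫ x in unitSq, T3.integrand x :=
    integral_sub (hi1.add hi2) hi3
  have e2 : ∫ x in unitSq, (T1.integrand x + T2.integrand x) =
      (∫ x in unitSq, T1.integrand x) + ∫ x in unitSq, T2.integrand x :=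
    integral_add hi1 hi2
  have hv : (legendreRepAt k hk hk0 hk1).value = T1.value + T2.value - T3.value := by
    rw [IntegralRep.value, legendreRepAt_domain, legendreRepAt_integrand,
      setIntegral_congr_fun isSemialgebraic_unitSq.measurableSet_holds heq, e1, e2,
      IntegralRep.value, IntegralRep.value, IntegralRep.value, h1d, h2d, h3d]
  rw [hv, hT1, hT2, hT3, IntegralRep.value_prod, IntegralRep.value_prod, IntegralRep.value_prod,
    eRepAt_sq_value, kapRepAt_compl_value, eRepAt_compl_value, kapRepAt_sq_value]
  exact Lawden1989_eq_3_8_29_holds k hk0 hk1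

/-- **Reduction to the canonical pair**: at each real-algebraic `k ∈ (0,1)` the crux instance is
equivalent to its single instance `[legendreRepAt k] − [arctanRep] ∈ KZ.relations` (identity
changes of variables, `equivalent_of_eqOn`). NO VACUITY, and the `∀ r r'` shape adds nothing.
[folklore] -/
theorem legendreAllModuliAt_iff_canonical (hk : IsAlgebraic ℚ k) (hk0 : 0 < k) (hk1 : k < 1) :
    LegendreAllModuliAt k ↔ Equivalent (legendreRepAt k hk hk0 hk1) arctanRep := by
  constructor
  · intro h
    exact h _ arctanRep rfl (fun x _ => rfl) rfl (fun x _ => rfl)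
  · intro h r r' hd hf hd' hf'
    have h1 : Equivalent r (legendreRepAt k hk hk0 hk1) :=
      equivalent_of_eqOn r _ ((legendreRepAt_domain hk hk0 hk1).trans hd.symm) hf
    have h2 : Equivalent arctanRep r' := by
      refine equivalent_of_eqOn arctanRep r' hd' fun x _ => ?_
      have hx : x ∈ r'.domain := by rw [hd']; trivial
      exact (hf' hx).symm
    exact h1.trans (h.trans h2)

/-- **NO EVALUATION KILL at any modulus**: every admissible pair `(r, r')` of the crux at a
real-algebraic `k ∈ (0,1)` has `value r = π/2 = value r'`; no additive invariant factoring through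
`KZ.eval` separates them. [cite: Lawden1989, §3.8 eq. (3.8.29)] -/
theorem values_of_admissible (hk : IsAlgebraic ℚ k) (hk0 : 0 < k) (hk1 : k < 1)
    (r : IntegralRep 2) (r' : IntegralRep 1) (hd : r.domain = unitSq)
    (hf : EqOn r.integrand (cruxIntegrandAt k) r.domain) (hd' : r'.domain = univ)
    (hf' : EqOn r'.integrand (fun x => 1 / (2 * (1 + x 0 ^ 2))) r'.domain) :
    r.value = Real.pi / 2 ∧ r'.value = Real.pi / 2 := by
  constructor
  · have h1 : Equivalent r (legendreRepAt k hk hk0 hk1) :=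
      equivalent_of_eqOn r _ ((legendreRepAt_domain hk hk0 hk1).trans hd.symm) hf
    rw [Equivalent.value_eq_holds h1, legendreRepAt_value]
  · have h2 : Equivalent arctanRep r' := by
      refine equivalent_of_eqOn arctanRep r' hd' fun x _ => ?_
      have hx : x ∈ r'.domain := by rw [hd']; trivial
      exact (hf' hx).symm
    rw [← Equivalent.value_eq_holds h2, arctanRep_value]

/-- **THE KILL CRITERION, FORMAL: a refutation of this crux would refute the summit statement.**
`arctanRep` has KZ's literal rational shape; `legendreRepAt k` is equivalent to SOME rational
representation (tree theorem `KZ.exists_isRational_equivalent_holds`, KZ §1.1 "algebraic ⇒ rational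
in more variables"); the values agree (`legendreRepAt_value`, Legendre's relation, proved). Hence
Conjecture 1 as typed (`KontsevichZagierPeriods`) implies every instance of the crux, and
`¬ LegendreAllModuli → ¬ KontsevichZagierPeriods`: the only conceivable weapon against the crux is a
new additive invariant of the full four-move calculus vanishing on `KZ.relations` and separating two
representations of equal value — a disproof of the period conjecture in this calculus. (Stated
contrapositively on purpose: the positive form is a CONDITIONAL proof, not a closing of the item.)
[cite: KontsevichZagier2001, §1.2 Conjecture 1] -/
theorem not_kontsevichZagierPeriods_of_not_legendreAllModuli (hneg : ¬ LegendreAllModuli) :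
    ¬ KontsevichZagierPeriods := by
  intro h
  apply hneg
  rw [legendreAllModuli_iff]
  intro k hk hk0 hk1
  rw [legendreAllModuliAt_iff_canonical hk hk0 hk1]
  obtain ⟨m, r₁, hr₁, he⟩ := exists_isRational_equivalent_holds (legendreRepAt k hk hk0 hk1)
  have hv : r₁.value = arctanRep.value := by
    rw [← Equivalent.value_eq_holds he, legendreRepAt_value, arctanRep_value]
  exact he.trans (h r₁ arctanRep hr₁ arctanRep_isRational hv)

/-- `√(1/2)` is real-algebraic (root of `X² − 1/2`). [folklore] -/
theorem isAlgebraic_sqrt_half : IsAlgebraic ℚ (Real.sqrt (1 / 2)) := by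
  refine ⟨Polynomial.X ^ 2 - Polynomial.C (1 / 2 : ℚ), ?_, ?_⟩
  · exact Polynomial.X_pow_sub_C_ne_zero (by norm_num) _
  · simp only [map_sub, map_pow, Polynomial.aeval_X, Polynomial.aeval_C,
      Real.sq_sqrt (show (0:ℝ) ≤ 1 / 2 by norm_num)]
    simp

/-- **The lemniscatic instance** (`k² = k′² = ½`): the crux implies the sibling crux
`GpcLegendreLemniscatic` (stmt-0280; same content as the tree's `legendreGlue_proof`, restated for
the Grothendieck decl). So every resistance result of `Cruxes/GpcLegendreLemniscatic/Disproof.lean`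
(refuted termwise transfer by Chudnovsky, necessity of rules (1) and (3), …) is inherited: a kill of
0280 would kill 3523, and 0280 resists. [folklore] -/
theorem gpcLegendreLemniscatic_of_legendreAllModuli (h : LegendreAllModuli) :
    GpcLegendreLemniscatic := by
  intro r r' hdom hint hdom' hint'
  have hk2 : Real.sqrt (1 / 2) ^ 2 = 1 / 2 := Real.sq_sqrt (by norm_num)
  have hk0 : 0 < Real.sqrt (1 / 2) := Real.sqrt_pos.mpr (by norm_num)
  have hk1 : Real.sqrt (1 / 2) < 1 := by
    rw [Real.sqrt_lt' one_pos]
    norm_num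
  refine h (Real.sqrt (1 / 2)) isAlgebraic_sqrt_half hk0 hk1 r r' hdom ?_ hdom' hint'
  intro x hx
  rw [hint hx]
  have h1 : ∀ y : ℝ, 1 - (1 - Real.sqrt (1 / 2) ^ 2) * y ^ 2 = 1 - y ^ 2 / 2 := fun y => by
    rw [hk2]; ring
  have h2 : ∀ y : ℝ, 1 - Real.sqrt (1 / 2) ^ 2 * y ^ 2 = 1 - y ^ 2 / 2 := fun y => by
    rw [hk2]; ring
  simp only [h1, h2]
  ring

/-- Contrapositive: a refutation of the lemniscatic crux refutes this one. [folklore] -/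
theorem not_legendreAllModuli_of_not_gpcLegendreLemniscatic (hneg : ¬ GpcLegendreLemniscatic) :
    ¬ LegendreAllModuli := fun h => hneg (gpcLegendreLemniscatic_of_legendreAllModuli h)

/-! ## §3 Necessary moves at EVERY modulus

Two additive invariants of sub-calculi, both from the sibling crux's landed Negative files, apply
verbatim at every modulus: `eval ∘ dimProj 2` (kills rules (1a), (1b), (2); sees `value r = π/2`)
and the o-minimal Euler characteristic of the domain `domainEuler` (kills rule (3) unconditionally
and rule (2) modulo van den Dries Ch. 4 (2.4); sees `E((0,1)²) − E(ℝ) = 1 − (−1) = 2`). So EVERY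
derivation of ANY instance of the crux uses a Newton–Leibniz move AND an additivity move — exactly
as the picked line `Sketch` does (M4 is rule (3); M1/M4/M5 use rule (1)). Neither invariant extends
to the full calculus, so neither is a weapon against the crux. -/

/-- **Newton–Leibniz is necessary at every modulus**: for an admissible left representation `r` at
a real-algebraic `k ∈ (0,1)` and ANY one-dimensional `r'`, `[r] − [r']` is not in the subgroup
generated by rules (1a), (1b), (2). [folklore] -/
theorem not_mem_closure_without_newtonLeibniz_at (hk : IsAlgebraic ℚ k) (hk0 : 0 < k) (hk1 : k < 1)
    (r : IntegralRep 2) (r' : IntegralRep 1) (hd : r.domain = unitSq)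
    (hf : EqOn r.integrand (cruxIntegrandAt k) r.domain) :
    of r - of r' ∉ AddSubgroup.closure (domainAddRel ∪ integrandAddRel ∪ changeOfVariablesRel) := by
  intro h
  have h0 := closure_sameDim_le_ker 2 h
  rw [AddMonoidHom.mem_ker, AddMonoidHom.coe_comp, Function.comp_apply, map_sub, dimProj_of,
    dimProj_of] at h0
  simp only [↓reduceIte, OfNat.one_ne_ofNat, eval_of, sub_zero] at h0
  have h1 : Equivalent r (legendreRepAt k hk hk0 hk1) :=
    equivalent_of_eqOn r _ ((legendreRepAt_domain hk hk0 hk1).trans hd.symm) hf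
  rw [Equivalent.value_eq_holds h1, legendreRepAt_value] at h0
  exact pi_div_two_ne_zero h0

/-- `domainEuler ([r] − [r']) = E((0,1)²) − E(ℝ) = 2` for ANY `r` on `(0,1)²` and `r'` on `ℝ`
(only the domains matter). [cite: Dries1998, Ch. 4 (2.1)] -/
theorem domainEuler_of_domains (r : IntegralRep 2) (r' : IntegralRep 1) (hd : r.domain = unitSq)
    (hd' : r'.domain = univ) : domainEuler (of r - of r') = 2 := by
  rw [map_sub, domainEuler_of, domainEuler_of, hd, hd', ← legendreRep_domain,
    realEuler_legendreRep_domain, realEuler_univ_one]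
  norm_num

/-- **Newton–Leibniz moves ALONE derive no instance of the crux** (unconditionally; in fact for
any pair of representations with these two domains, at any modulus, algebraic or not).
[cite: Dries1998, Ch. 4 (2.11)] -/
theorem not_mem_closure_newtonLeibniz_of_domains (r : IntegralRep 2) (r' : IntegralRep 1)
    (hd : r.domain = unitSq) (hd' : r'.domain = univ) :
    of r - of r' ∉ AddSubgroup.closure newtonLeibnizRel := by
  intro h
  have hle : AddSubgroup.closure newtonLeibnizRel ≤ domainEuler.ker :=
    (AddSubgroup.closure_le _).mpr fun c hc => domainEuler_eq_zero_of_mem_newtonLeibnizRel hc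
  have h0 := hle h
  rw [AddMonoidHom.mem_ker, domainEuler_of_domains r r' hd hd'] at h0
  norm_num at h0

/-- **Additivity is necessary at every modulus** (modulo van den Dries Ch. 4 (2.4), the tree's named
fact `Dries1998_ch4_prop_2_4`): `[r] − [r']` is not in the subgroup generated by rules (2) and (3).
[cite: Dries1998, Ch. 4 (2.4)] -/
theorem not_mem_closure_without_additivity_of_domains
    (hE : Literature.ModelTheory.ExponentialFields.Dries1998_ch4_prop_2_4
      Literature.ModelTheory.ExponentialFields.Language.orderedRing ℝ)
    (r : IntegralRep 2) (r' : IntegralRep 1) (hd : r.domain = unitSq) (hd' : r'.domain = univ) :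
    of r - of r' ∉ AddSubgroup.closure (changeOfVariablesRel ∪ newtonLeibnizRel) := by
  intro h
  have h0 := closure_cov_nl_le_ker_domainEuler hE h
  rw [AddMonoidHom.mem_ker, domainEuler_of_domains r r' hd hd'] at h0
  norm_num at h0


/-! ## §4 The scalar hypotheses `IsAlgebraic ℚ k`, `0 < k`, `k < 1` are NOT load-bearing

There is no `legendreAllModuli_false_without_<H>` theorem to be had for the three scalar
hypotheses: dropping any of them produces NO counterexample.
* SIGN: only `k²` occurs, `LegendreAllModuliAt (−k) ↔ LegendreAllModuliAt k`; `0 < k` is a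
  normalisation of `k ≠ 0`… and even `k = 0` is harmless:
* `k = 0`: the three-term integrand collapses ON `(0,1)²` to `1/√(1 − x₁²)` (the first and third
  terms cancel identically, `e_1 = 1`), value `1 · π/2 = π/2 = value r'` (`values_at_zero`); so the
  two-modulus symmetric shape SURVIVES the nodal limit — in contrast with the single-modulus shape
  `2e_m κ_m − κ_m κ_m` of the sibling crux, which is false at `m = 0` by value `(π/2)²`
  (`not_legendreShape_zero`, landed). `LegendreAllModuliAt 0 ↔ [1]·[a] ~ arctanRep` is then a
  four-move exercise (swap; Newton–Leibniz in the constant variable; `x = s/√(1+s²)`; half-line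
  tail M5), not carried out here since `k = 0` lies outside the crux.
* `k = ±1`: `1 − k² = 0` and the second term is `1/(√(1−x₀²)(1 − x₁²))`, NOT absolutely integrable
  on `(0,1)²` while the other two terms are integrable near `x₁ = 1`: no admissible `r` exists and
  `LegendreAllModuliAt 1` holds VACUOUSLY (proved below from the divergence of `∫₀¹ dy/(1−y²)`:
  `legendreAllModuliAt_one`).
* `|k| > 1`: with Mathlib's junk conventions (`√(negative) = 0`, `a/0 = 0`) the factors are
  truncated at `x = 1/k`; by the reciprocal-modulus transformation (`K ↦ (1/k)K(1/k)`,
  `E ↦ k[E(1/k) − (1−1/k²)K(1/k)]`, `K(ik′) = K(μ′)/k`, `E(ik′) = kE(μ′)`, `μ = 1/k`) the value is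
  AGAIN `E(μ)K(μ′) + E(μ′)K(μ) − K(μ)K(μ′) = π/2`; numerically confirmed at `k = 1.25, 2, 3.7` to
  `2·10⁻¹⁶` (compute job j016517, `num/value_check.py`). No value kill for `k > 1` either.
* `IsAlgebraic ℚ k` dropped: for transcendental `k` NO `ℚ`-semialgebraic `r` with this integrand
  exists (the value of its integrand at the rational point `(½,½)` is `1/√((1 − k²/4)(¾ + k²/4))`,
  and values of `ℚ`-semialgebraic functions at rational points are algebraic), so the instance is
  vacuous — PROVED below: `isAlgebraic_of_admissible`, `legendreAllModuli_iff_forall_Ioo` (the crux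
  is EQUIVALENT to its version without the hypothesis), `legendreAllModuliAt_of_transcendental`.
  `IsAlgebraic` is the well-formedness (non-vacuity) condition of the crux, not a restriction.
Honest reading for the provers: the conclusion is (conjecturally, and along the picked line `Sketch`,
whose sphero-conal map needs only `0 ≤ m ≤ 1`) true for EVERY real `k`; nothing in a proof may
"use" `0 < k < 1` except to guarantee integrability of the separate factors `κ_{k²}`, `κ_{1−k²}`. -/

/-- Only `k²` occurs in the crux integrand. [folklore] -/
theorem cruxIntegrandAt_neg (k : ℝ) : cruxIntegrandAt (-k) = cruxIntegrandAt k := by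
  funext x
  simp only [cruxIntegrandAt, neg_sq]

/-- **SIGN is a normalisation**: `LegendreAllModuliAt (−k) ↔ LegendreAllModuliAt k`. [folklore] -/
theorem legendreAllModuliAt_neg_iff (k : ℝ) : LegendreAllModuliAt (-k) ↔ LegendreAllModuliAt k := by
  unfold LegendreAllModuliAt
  rw [cruxIntegrandAt_neg]

/-! ### `IsAlgebraic ℚ k` is implied by the other hypotheses -/

/-- The value of the crux integrand at the rational point `(½,½)`:
`1/(√(1 − k²/4)·√(1 − (1−k²)/4))` (for `k² < 4`). [folklore] -/
theorem cruxIntegrandAt_half_half (k : ℝ) (hk : k ^ 2 < 4) :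
    cruxIntegrandAt k ![1 / 2, 1 / 2] =
      1 / (Real.sqrt (1 - k ^ 2 * (1 / 2) ^ 2) * Real.sqrt (1 - (1 - k ^ 2) * (1 / 2) ^ 2)) := by
  have hg : (0:ℝ) < 1 - (1 / 2 : ℝ) ^ 2 := by norm_num
  have hα : 0 < 1 - k ^ 2 * (1 / 2 : ℝ) ^ 2 := by nlinarith
  have hβ : 0 < 1 - (1 - k ^ 2) * (1 / 2 : ℝ) ^ 2 := by nlinarith [sq_nonneg k]
  simp only [cruxIntegrandAt, Matrix.cons_val_zero, Matrix.cons_val_one]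
  rw [Real.sqrt_mul hg.le (1 - (1 - k ^ 2) * (1 / 2) ^ 2),
    Real.sqrt_mul hg.le (1 - k ^ 2 * (1 / 2) ^ 2)]
  have hg2 : Real.sqrt (1 - (1 / 2 : ℝ) ^ 2) ^ 2 = 1 - (1 / 2 : ℝ) ^ 2 := Real.sq_sqrt hg.le
  have ha2 : Real.sqrt (1 - k ^ 2 * (1 / 2 : ℝ) ^ 2) ^ 2 = 1 - k ^ 2 * (1 / 2 : ℝ) ^ 2 :=
    Real.sq_sqrt hα.le
  have hb2 : Real.sqrt (1 - (1 - k ^ 2) * (1 / 2 : ℝ) ^ 2) ^ 2 = 1 - (1 - k ^ 2) * (1 / 2 : ℝ) ^ 2 :=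
    Real.sq_sqrt hβ.le
  set g := Real.sqrt (1 - (1 / 2 : ℝ) ^ 2) with hg_def
  set a := Real.sqrt (1 - k ^ 2 * (1 / 2 : ℝ) ^ 2) with ha_def
  set b := Real.sqrt (1 - (1 - k ^ 2) * (1 / 2 : ℝ) ^ 2) with hb_def
  have hg0 : g ≠ 0 := (Real.sqrt_pos.2 hg).ne'
  have ha0 : a ≠ 0 := (Real.sqrt_pos.2 hα).ne'
  have hb0 : b ≠ 0 := (Real.sqrt_pos.2 hβ).ne'
  rw [show (1:ℝ) / (a * b) = (a ^ 2 + b ^ 2 - 1) / (g ^ 2 * a * b) from by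
    rw [ha2, hb2, hg2]; field_simp; ring]
  field_simp

/-- Numerals `≥ 2` are real-algebraic. [folklore] -/
theorem isAlgebraic_ofNat' (n : ℕ) [n.AtLeastTwo] : IsAlgebraic ℚ (OfNat.ofNat n : ℝ) := by
  have h := isAlgebraic_nat (R := ℚ) (A := ℝ) (OfNat.ofNat n)
  rwa [Nat.cast_ofNat] at h

/-- **`IsAlgebraic ℚ k` is IMPLIED by admissibility**: if some `ℚ`-semialgebraic integrable `r` on
`(0,1)²` has the crux integrand at a modulus `0 < k < 1`, then `k` is algebraic — the value of a
`ℚ`-semialgebraic function at the rational point `(½,½)` is algebraic (tree theorem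
`IsSemialgebraicFunOn.isAlgebraic_apply`), and that value `1/√((1 − k²/4)(¾ + k²/4))` pins `k²` as a
root of a quadratic with algebraic coefficients. [folklore] -/
theorem isAlgebraic_of_admissible {k : ℝ} (hk0 : 0 < k) (hk1 : k < 1) (r : IntegralRep 2)
    (hd : r.domain = unitSq) (hf : EqOn r.integrand (cruxIntegrandAt k) r.domain) :
    IsAlgebraic ℚ k := by
  have hα : 0 < 1 - k ^ 2 * (1 / 2 : ℝ) ^ 2 := by nlinarith
  have hβ : 0 < 1 - (1 - k ^ 2) * (1 / 2 : ℝ) ^ 2 := by nlinarith [sq_nonneg k]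
  have hhalf : IsAlgebraic ℚ (1 / 2 : ℝ) := by
    rw [one_div]
    exact (isAlgebraic_ofNat' 2).inv
  -- the rational point `(½,½)` of the square
  have hmem : (![1 / 2, 1 / 2] : Fin 2 → ℝ) ∈ r.domain := by
    rw [hd]
    intro i
    fin_cases i <;> simp <;> norm_num
  have halg : ∀ i, IsAlgebraic ℚ ((![1 / 2, 1 / 2] : Fin 2 → ℝ) i) := by
    intro i
    fin_cases i <;> simpa using hhalf
  have hv : IsAlgebraic ℚ (r.integrand ![1 / 2, 1 / 2]) :=
    r.isSemialgebraicFunOn_integrand.isAlgebraic_apply hmem halg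
  rw [hf hmem, cruxIntegrandAt_half_half k (by nlinarith), one_div] at hv
  -- `ab = v⁻¹` is algebraic, hence so is `(ab)² = (1 − k²/4)(1 − (1−k²)/4)`
  have hab := IsAlgebraic.inv_iff.1 hv
  have hQ : IsAlgebraic ℚ ((1 - k ^ 2 * (1 / 2 : ℝ) ^ 2) * (1 - (1 - k ^ 2) * (1 / 2 : ℝ) ^ 2)) := by
    have h2 := hab.pow 2
    rwa [mul_pow, Real.sq_sqrt hα.le, Real.sq_sqrt hβ.le] at h2
  -- `(k² − ½)² = 49/4 − 16·(ab)²`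
  have h494 : IsAlgebraic ℚ (49 / 4 : ℝ) := by
    rw [div_eq_mul_inv]
    exact (isAlgebraic_ofNat' 49).mul (isAlgebraic_ofNat' 4).inv
  have h16 : IsAlgebraic ℚ (16 : ℝ) := isAlgebraic_ofNat' 16
  have hsq : IsAlgebraic ℚ ((k ^ 2 - 1 / 2) ^ 2) := by
    have e : (k ^ 2 - 1 / 2) ^ 2 =
        49 / 4 - 16 * ((1 - k ^ 2 * (1 / 2 : ℝ) ^ 2) * (1 - (1 - k ^ 2) * (1 / 2 : ℝ) ^ 2)) := by
      ring
    rw [e]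
    exact h494.sub (h16.mul hQ)
  have hu : IsAlgebraic ℚ (k ^ 2 - 1 / 2) := hsq.of_pow two_pos
  have hk2 : IsAlgebraic ℚ (k ^ 2) := by
    have h := hu.add hhalf
    rwa [sub_add_cancel] at h
  exact hk2.of_pow two_pos

/-- **`IsAlgebraic` is REDUNDANT in the crux** (not load-bearing — indeed implied by the other
hypotheses): `LegendreAllModuli ↔ ∀ k, 0 < k → k < 1 → LegendreAllModuliAt k`. [folklore] -/
theorem legendreAllModuli_iff_forall_Ioo :
    LegendreAllModuli ↔ ∀ k : ℝ, 0 < k → k < 1 → LegendreAllModuliAt k := by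
  rw [legendreAllModuli_iff]
  constructor
  · intro h k hk0 hk1 r r' hd hf hd' hf'
    exact h k (isAlgebraic_of_admissible hk0 hk1 r hd hf) hk0 hk1 r r' hd hf hd' hf'
  · intro h k _ hk0 hk1
    exact h k hk0 hk1

/-- For TRANSCENDENTAL `k ∈ (0,1)` the instance is vacuous (no admissible `r`). [folklore] -/
theorem legendreAllModuliAt_of_transcendental (hk0 : 0 < k) (hk1 : k < 1)
    (ht : Transcendental ℚ k) : LegendreAllModuliAt k :=
  fun r _ hd hf _ _ => (ht (isAlgebraic_of_admissible hk0 hk1 r hd hf)).elim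


/-- **At `k = 0` the integrand collapses to `1/√(1 − x₁²)` on `(0,1)²`** (first and third terms
cancel identically; `√(1−x₀²)/√(1−x₀²) = 1`). [folklore] -/
theorem cruxIntegrandAt_zero_eqOn : EqOn (cruxIntegrandAt 0) (fun x => aFun (x 1)) unitSq := by
  intro x hx
  have h0 : 0 < 1 - x 0 ^ 2 := one_sub_sq_pos (hx 0)
  have hs : Real.sqrt (1 - x 0 ^ 2) ≠ 0 := (Real.sqrt_pos.2 h0).ne'
  simp only [cruxIntegrandAt, aFun, ne_eq, OfNat.ofNat_ne_zero, not_false_eq_true, zero_pow,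
    zero_mul, sub_zero, one_mul, mul_one, Real.sqrt_one, div_self hs]
  ring

/-- The constant representation `[(0,1), 1]` (value `1`). [folklore] -/
def oneRep : IntegralRep 1 :=
  unitRep (fun _ => 1) ((isSemialgebraicFunOn_ratCast isSemialgebraic_unitIoo 1).congr fun x _ => by simp)
    ((continuousOn_const.integrableOn_compact isCompact_Icc).mono_set Ioo_subset_Icc_self)

/-- `value [(0,1), 1] = 1`. [folklore] -/
theorem oneRep_value : oneRep.value = 1 := by
  rw [oneRep, unitRep_value, setIntegral_const]
  simp [Measure.real, Real.volume_Ioo]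

/-- **`0 < k` is not load-bearing**: at `k = 0` every admissible pair STILL has equal values
`π/2 = π/2` (witness `[1]·[a]`, `a = 1/√(1−t²)`, `value = 1 · K(0) = π/2`). [folklore] -/
theorem values_at_zero (r : IntegralRep 2) (r' : IntegralRep 1) (hd : r.domain = unitSq)
    (hf : EqOn r.integrand (cruxIntegrandAt 0) r.domain) (hd' : r'.domain = univ)
    (hf' : EqOn r'.integrand (fun x => 1 / (2 * (1 + x 0 ^ 2))) r'.domain) :
    r.value = Real.pi / 2 ∧ r'.value = Real.pi / 2 := by
  constructor
  · have h1 : Equivalent r (oneRep.prod aRep) := by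
      refine equivalent_of_eqOn r _ ((prod_unitRep_domain _ _ _ _ _ _).trans hd.symm) fun x hx => ?_
      have hx' : x ∈ unitSq := by rw [hd] at hx; exact hx
      rw [hf hx, show oneRep.prod aRep = (unitRep _ _ _).prod (unitRep _ _ _) from rfl,
        prod_unitRep_integrand_apply, one_mul]
      exact cruxIntegrandAt_zero_eqOn hx'
    rw [Equivalent.value_eq_holds h1, IntegralRep.value_prod, oneRep_value, aRep_value, one_mul]
  · have h2 : Equivalent arctanRep r' := by
      refine equivalent_of_eqOn arctanRep r' hd' fun x _ => ?_
      have hx : x ∈ r'.domain := by rw [hd']; trivial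
      exact (hf' hx).symm
    rw [← Equivalent.value_eq_holds h2, arctanRep_value]

/-- `LegendreAllModuliAt 0` is the statement `[1]·[a] ~ arctanRep` (a four-move exercise outside the
crux's range; recorded, not proved). [folklore] -/
theorem legendreAllModuliAt_zero_iff : LegendreAllModuliAt 0 ↔ Equivalent (oneRep.prod aRep) arctanRep := by
  constructor
  · intro h
    refine h _ arctanRep (prod_unitRep_domain _ _ _ _ _ _) (fun x hx => ?_) rfl (fun x _ => rfl)
    have hdom : (oneRep.prod aRep).domain = unitSq := prod_unitRep_domain _ _ _ _ _ _
    have hx' : x ∈ unitSq := by rw [hdom] at hx; exact hx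
    rw [show oneRep.prod aRep = (unitRep _ _ _).prod (unitRep _ _ _) from rfl,
      prod_unitRep_integrand_apply, one_mul]
    exact (cruxIntegrandAt_zero_eqOn hx').symm
  · intro h r r' hd hf hd' hf'
    have h1 : Equivalent r (oneRep.prod aRep) := by
      refine equivalent_of_eqOn r _ ((prod_unitRep_domain _ _ _ _ _ _).trans hd.symm) fun x hx => ?_
      have hx' : x ∈ unitSq := by rw [hd] at hx; exact hx
      rw [hf hx, show oneRep.prod aRep = (unitRep _ _ _).prod (unitRep _ _ _) from rfl,
        prod_unitRep_integrand_apply, one_mul]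
      exact cruxIntegrandAt_zero_eqOn hx'
    have h2 : Equivalent arctanRep r' := by
      refine equivalent_of_eqOn arctanRep r' hd' fun x _ => ?_
      have hx : x ∈ r'.domain := by rw [hd']; trivial
      exact (hf' hx).symm
    exact h1.trans (h.trans h2)


/-! ### `k = 1`: the instance is VACUOUS (no admissible `r`: the integrand is not integrable) -/

/-- `y ↦ 1/(1 − y²)` is NOT integrable on `(0,1)` (compare with `(y − 1)⁻¹`, Mathlib's
`intervalIntegrable_sub_inv_iff`). [folklore] -/
theorem not_integrableOn_inv_one_sub_sq :
    ¬ IntegrableOn (fun y : ℝ => 1 / (1 - y ^ 2)) (Ioo 0 1) := by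
  intro h
  have h2 : IntegrableOn (fun y : ℝ => (y - 1)⁻¹) (Ioo 0 1) := by
    refine (h.const_mul 2).mono' ?_ ?_
    · refine ContinuousOn.aestronglyMeasurable ?_ measurableSet_Ioo
      exact ContinuousOn.inv₀ (continuousOn_id.sub continuousOn_const)
        fun y hy => sub_ne_zero.2 hy.2.ne
    · refine (ae_restrict_mem measurableSet_Ioo).mono fun y hy => ?_
      have hy1 : 0 < 1 - y := by linarith [hy.2]
      have hy2 : 0 < 1 - y ^ 2 := one_sub_sq_pos hy
      rw [Real.norm_eq_abs, abs_inv, show |y - 1| = 1 - y by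
        rw [abs_sub_comm]; exact abs_of_pos hy1]
      rw [inv_eq_one_div, div_le_iff₀ hy1, mul_one_div, mul_comm, ← mul_div_assoc,
        le_div_iff₀ hy2]
      nlinarith [hy.1, hy.2]
  have h3 : IntervalIntegrable (fun y : ℝ => (y - 1)⁻¹) volume 0 1 :=
    (intervalIntegrable_iff_integrableOn_Ioo_of_le zero_le_one).2 h2
  rcases intervalIntegrable_sub_inv_iff.1 h3 with h01 | hmem
  · exact zero_ne_one h01
  · exact hmem (by simp)



/-- At `k = 1` the crux integrand is, on `(0,1)²`,
`a(x₁) + a(x₀)·(1/(1 − x₁²)) − (1/(1 − x₀²))·a(x₁)` with `a(t) = 1/√(1−t²)`. [folklore] -/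
theorem cruxIntegrandAt_one_eq {x : Fin 2 → ℝ} (hx : x ∈ unitSq) :
    cruxIntegrandAt 1 x =
      1 / Real.sqrt (1 - x 1 ^ 2) + 1 / Real.sqrt (1 - x 0 ^ 2) * (1 / (1 - x 1 ^ 2)) -
        1 / (1 - x 0 ^ 2) * (1 / Real.sqrt (1 - x 1 ^ 2)) := by
  have h0 : 0 < 1 - x 0 ^ 2 := one_sub_sq_pos (hx 0)
  have h1 : 0 < 1 - x 1 ^ 2 := one_sub_sq_pos (hx 1)
  have hs0 : Real.sqrt (1 - x 0 ^ 2) ≠ 0 := (Real.sqrt_pos.2 h0).ne'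
  simp only [cruxIntegrandAt, one_pow, one_mul, sub_self, zero_mul, sub_zero, mul_one,
    Real.sqrt_mul_self h0.le, Real.sqrt_mul_self h1.le, Real.sqrt_one, div_self hs0]
  ring

/-- From integrability of `x ↦ g (x 1)` on the product `{x₀ ∈ (0,½)} ∩ {x₁ ∈ (0,1)}` to
integrability of `g` on `(0,1)` (Fubini through `ℝ² ≃ ℝ × ℝ`: almost every fibre is integrable, and
the base `(0,½)` has positive measure). [folklore] -/
theorem integrableOn_of_integrableOn_snd (g : ℝ → ℝ)
    (hg : IntegrableOn (fun x : Fin 2 → ℝ => g (x 1))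
      {x : Fin 2 → ℝ | x 0 ∈ Ioo (0:ℝ) (1 / 2) ∧ x 1 ∈ Ioo (0:ℝ) 1}) :
    IntegrableOn g (Ioo 0 1) := by
  set A : Set (Fin 2 → ℝ) := {x | x 0 ∈ Ioo (0:ℝ) (1 / 2) ∧ x 1 ∈ Ioo (0:ℝ) 1} with hA
  have hAm : MeasurableSet A :=
    (measurableSet_Ioo.preimage (measurable_pi_apply 0)).inter
      (measurableSet_Ioo.preimage (measurable_pi_apply 1))
  set e : (Fin 2 → ℝ) ≃ᵐ ℝ × ℝ := MeasurableEquiv.finTwoArrow with he_def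
  have he : MeasurePreserving e volume volume := volume_preserving_finTwoArrow ℝ
  have c0 : ∀ p : ℝ × ℝ, e.symm p 0 = p.1 := fun p => by simp [he_def]
  have c1 : ∀ p : ℝ × ℝ, e.symm p 1 = p.2 := fun p => by simp [he_def]
  have hmem : ∀ p : ℝ × ℝ, e.symm p ∈ A ↔ p.1 ∈ Ioo (0:ℝ) (1 / 2) ∧ p.2 ∈ Ioo (0:ℝ) 1 :=
    fun p => by rw [hA, mem_setOf_eq, c0, c1]
  -- the integrand extended by zero, transported to the product
  set G : (Fin 2 → ℝ) → ℝ := A.indicator fun x => g (x 1) with hG_def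
  have hG : Integrable G := (integrable_indicator_iff hAm).mpr hg
  have hG2 : Integrable (fun p : ℝ × ℝ => G (e.symm p))
      ((volume : Measure ℝ).prod (volume : Measure ℝ)) := by
    have h := ((he.symm e).integrable_comp_emb e.symm.measurableEmbedding (g := G)).mpr hG
    rw [← Measure.volume_eq_prod]
    exact h
  -- almost every fibre `b ↦ G (a, b)` is integrable
  have hae : ∀ᵐ a : ℝ, Integrable (fun b : ℝ => G (e.symm (a, b))) := hG2.prod_right_ae
  -- the base `(0,½)` has positive measure, so some fibre over it is integrable
  have hSvol : volume (Ioo (0:ℝ) (1 / 2)) ≠ 0 := by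
    rw [Real.volume_Ioo]
    norm_num
  haveI : (ae (volume.restrict (Ioo (0:ℝ) (1 / 2)))).NeBot :=
    ae_neBot.2 fun h0 => hSvol (Measure.restrict_eq_zero.1 h0)
  have hae' : ∀ᵐ a ∂(volume.restrict (Ioo (0:ℝ) (1 / 2))),
      a ∈ Ioo (0:ℝ) (1 / 2) ∧ Integrable (fun b : ℝ => G (e.symm (a, b))) :=
    (ae_restrict_mem measurableSet_Ioo).and (ae_restrict_of_ae hae)
  obtain ⟨a, haS, ha⟩ := hae'.exists
  -- that fibre is the indicator of `(0,1)` times `g`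
  have hfib : (fun b : ℝ => G (e.symm (a, b))) = (Ioo (0:ℝ) 1).indicator g := by
    ext b
    by_cases hb : b ∈ Ioo (0:ℝ) 1
    · rw [Set.indicator_of_mem hb, hG_def, Set.indicator_of_mem ((hmem (a, b)).2 ⟨haS, hb⟩), c1]
    · rw [Set.indicator_of_notMem hb, hG_def,
        Set.indicator_of_notMem (fun h => hb ((hmem (a, b)).1 h).2)]
  rw [hfib, integrable_indicator_iff measurableSet_Ioo] at ha
  exact ha

/-- **At `k = 1` the crux integrand is NOT absolutely integrable on `(0,1)²`**: on the sub-square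
`{x₀ < ½}` the first and third terms are integrable, so the second, `1/(√(1−x₀²)(1−x₁²)) ≥ 1/(1−x₁²)`,
would be integrable, contradicting `∫₀¹ dy/(1−y²) = ∞`. [folklore] -/
theorem not_integrableOn_cruxIntegrandAt_one : ¬ IntegrableOn (cruxIntegrandAt 1) unitSq := by
  intro h
  set A : Set (Fin 2 → ℝ) := {x | x 0 ∈ Ioo (0:ℝ) (1 / 2) ∧ x 1 ∈ Ioo (0:ℝ) 1} with hA
  have hAsub : A ⊆ unitSq := by
    intro x hx i
    fin_cases i
    · exact ⟨hx.1.1, hx.1.2.trans (by norm_num)⟩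
    · exact hx.2
  have hAm : MeasurableSet A :=
    (measurableSet_Ioo.preimage (measurable_pi_apply 0)).inter
      (measurableSet_Ioo.preimage (measurable_pi_apply 1))
  -- T1 = [1]·[a] is integrable on the square
  have hT1 : IntegrableOn (fun x : Fin 2 → ℝ => 1 / Real.sqrt (1 - x 1 ^ 2)) unitSq := by
    have hi := (oneRep.prod aRep).integrableOn
    have hd : (oneRep.prod aRep).domain = unitSq := prod_unitRep_domain _ _ _ _ _ _
    rw [hd] at hi
    refine hi.congr_fun (fun x _ => ?_) isSemialgebraic_unitSq.measurableSet_holds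
    rw [show oneRep.prod aRep = (unitRep _ _ _).prod (unitRep _ _ _) from rfl,
      prod_unitRep_integrand_apply, one_mul, aFun]
  -- T3 = (1/(1−x₀²))·a(x₁) ≤ (4/3)·a(x₁) on A
  have hT3 : IntegrableOn (fun x : Fin 2 → ℝ => 1 / (1 - x 0 ^ 2) * (1 / Real.sqrt (1 - x 1 ^ 2))) A := by
    refine ((hT1.mono_set hAsub).const_mul (4 / 3)).mono' ?_ ?_
    · exact (by fun_prop : Measurable fun x : Fin 2 → ℝ =>
        1 / (1 - x 0 ^ 2) * (1 / Real.sqrt (1 - x 1 ^ 2))).aestronglyMeasurable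
    · refine (ae_restrict_mem hAm).mono fun x hx => ?_
      have h0 : 0 < 1 - x 0 ^ 2 := one_sub_sq_pos (hAsub hx 0)
      have h1 : 0 < 1 - x 1 ^ 2 := one_sub_sq_pos (hAsub hx 1)
      have ha : 0 < 1 / Real.sqrt (1 - x 1 ^ 2) := by positivity
      have hb : 1 / (1 - x 0 ^ 2) ≤ 4 / 3 := by
        rw [div_le_div_iff₀ h0 (by norm_num : (0:ℝ) < 3)]
        nlinarith [hx.1.1, hx.1.2]
      rw [Real.norm_eq_abs, abs_of_pos (mul_pos (by positivity) ha)]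
      exact mul_le_mul_of_nonneg_right hb ha.le
  -- hence T2 = f − T1 + T3 is integrable on A
  have hT2 : IntegrableOn
      (fun x : Fin 2 → ℝ => 1 / Real.sqrt (1 - x 0 ^ 2) * (1 / (1 - x 1 ^ 2))) A := by
    have hf : IntegrableOn (cruxIntegrandAt 1) A := h.mono_set hAsub
    have h3 := (hf.sub (hT1.mono_set hAsub)).add hT3
    refine h3.congr_fun (fun x hx => ?_) hAm
    simp only [Pi.add_apply, Pi.sub_apply]
    rw [cruxIntegrandAt_one_eq (hAsub hx)]
    ring
  -- and so is its minorant `1/(1 − x₁²)`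
  have hg : IntegrableOn (fun x : Fin 2 → ℝ => 1 / (1 - x 1 ^ 2)) A := by
    refine hT2.mono' ?_ ?_
    · exact (by fun_prop : Measurable fun x : Fin 2 → ℝ => 1 / (1 - x 1 ^ 2)).aestronglyMeasurable
    · refine (ae_restrict_mem hAm).mono fun x hx => ?_
      have h0 : 0 < 1 - x 0 ^ 2 := one_sub_sq_pos (hAsub hx 0)
      have h1 : 0 < 1 - x 1 ^ 2 := one_sub_sq_pos (hAsub hx 1)
      have hs : Real.sqrt (1 - x 0 ^ 2) ≤ 1 := Real.sqrt_le_one.mpr (by nlinarith [sq_nonneg (x 0)])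
      have hge : 1 ≤ 1 / Real.sqrt (1 - x 0 ^ 2) := by
        rw [le_div_iff₀ (Real.sqrt_pos.2 h0), one_mul]
        exact hs
      have hc : 0 < 1 / (1 - x 1 ^ 2) := by positivity
      rw [Real.norm_eq_abs, abs_of_pos hc]
      calc 1 / (1 - x 1 ^ 2) = 1 * (1 / (1 - x 1 ^ 2)) := (one_mul _).symm
        _ ≤ 1 / Real.sqrt (1 - x 0 ^ 2) * (1 / (1 - x 1 ^ 2)) :=
          mul_le_mul_of_nonneg_right hge hc.le
  exact not_integrableOn_inv_one_sub_sq (integrableOn_of_integrableOn_snd (fun y => 1 / (1 - y ^ 2)) hg)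

/-- **`k < 1` is load-bearing only for well-formedness: `LegendreAllModuliAt 1` holds VACUOUSLY**
(no admissible `r` exists, its integrand not being absolutely integrable). [folklore] -/
theorem legendreAllModuliAt_one : LegendreAllModuliAt 1 := by
  intro r r' hd hf _ _
  exfalso
  apply not_integrableOn_cruxIntegrandAt_one
  have hi := r.integrableOn
  rw [hd] at hi hf
  exact hi.congr_fun hf isSemialgebraic_unitSq.measurableSet_holds


/-! ## §5 Line `Sketch` (PICKED, lead `prover-line-…-3523-0`): audit of the five stubs

Verdict: NO STUB IS FALSE OR MIS-STATED; the composition `LegendreAllModuli_of` of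
`Lines/Sketch.lean` type-checks from the five stubs (rc 0), so there is no sufficiency gap.
* M1 `stub_symmetrise` — LANDED (`Theorems/UnfoldedStokesLegendreAllModuliStubSymmetrise.lean`);
  its pointwise identity is re-checked below for ALL `x` as a ring identity (`symmetrise_pointwise`).
* M2 `stub_octantTransfer` — the load-bearing new move. Certified here in the lead's VERBATIM
  integrand shape: `1 − X² − Z² = (1−x₀²)(1−x₁²)` (`one_sub_normSq_spheroConal`), `det DΦ_m > 0`
  (`spheroConalDet_pos`), `Φ_m((0,1)²) ⊆ Q` (`spheroConal_mem_quarterDisc`) and the Jacobian identity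
  `F_m = (1 − X² − Z²)^{-1/2} · |det DΦ_m|` (`octant_pointwise`) for every `0 ≤ m ≤ 1` (not only
  `(0,1)`); numerically (j016517) the identity holds to `9·10⁻³⁰` and `Φ_m` has exactly ONE preimage
  in the open square for random targets (bijectivity; kernel-checked as `spheroConal_bijOn` in
  `Cruxes/GpcLegendreLemniscatic/SketchIdeator2g2.lean` for `m ∈ (0,1)`). Remaining prover work is
  routine: `HasFDerivWithinAt` of `Φ_m` on the open square (radicands `> 0`), `ℚ`-semialgebraicity
  of `Φ_m` (needs `IsAlgebraic ℚ m` — present), integrability of the target transported by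
  `integrableOn_image_iff_integrableOn_abs_det_fderiv_smul`.
* M3 `stub_discToStrip` — density identity certified (`strip_pointwise`): with
  `X = s√(1−y²)/√(1+s²)`, `(1 − X² − y²)^{-1/2} · √(1−y²)(1+s²)^{-3/2} = 1/(1+s²)`; `Θ` is a
  bijection `H → Q` with inverse `s = X/√(1 − X² − y²)`.
* M4 `stub_stripNewtonLeibniz`, M5 `stub_halfLineTail` — LANDED
  (`Theorems/UnfoldedStokesLegendreAllModuliStubStripNewtonLeibniz.lean`, `…StubHalfLineTail.lean`).
Hypothesis mutation of M2: `m ∈ Ioo 0 1` may be weakened to `m ∈ Icc 0 1` (all four certificates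
below hold there; at `m = 0`, `Φ_0(x,y) = (x√(1−y²), y)`); `IsAlgebraic ℚ m` is needed only for the
semialgebraicity of `Φ_m` (for transcendental `m` the hypothesis `q` cannot exist: vacuous). -/

section LineSketch

variable {m : ℝ} {x : Fin 2 → ℝ}

/-- Jacobi's sphero-conal map `Φ_m(x₀,x₁) = (x₀√(1−(1−m)x₁²), x₁√(1−m x₀²))`. [folklore] -/
def spheroConal (m : ℝ) (x : Fin 2 → ℝ) : Fin 2 → ℝ :=
  ![x 0 * Real.sqrt (1 - (1 - m) * x 1 ^ 2), x 1 * Real.sqrt (1 - m * x 0 ^ 2)]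

/-- Its Jacobian determinant `(1 − m x₀² − (1−m)x₁²)/(√(1−m x₀²)√(1−(1−m)x₁²))`. [folklore] -/
def spheroConalDet (m : ℝ) (x : Fin 2 → ℝ) : ℝ :=
  (1 - m * x 0 ^ 2 - (1 - m) * x 1 ^ 2) /
    (Real.sqrt (1 - m * x 0 ^ 2) * Real.sqrt (1 - (1 - m) * x 1 ^ 2))

/-- The lead's one-representation Legendre integrand `F_m`, VERBATIM the hypothesis shape of
`stub_octantTransfer` (and the conclusion shape of `stub_symmetrise` at `m = k²`). [folklore] -/
def symIntegrand (m : ℝ) (x : Fin 2 → ℝ) : ℝ :=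
  1 / Real.sqrt ((1 - x 0 ^ 2) * (1 - m * x 0 ^ 2)) *
        (Real.sqrt (1 - (1 - m) * x 1 ^ 2) / Real.sqrt (1 - x 1 ^ 2)) +
      Real.sqrt (1 - m * x 0 ^ 2) / Real.sqrt (1 - x 0 ^ 2) *
        (1 / Real.sqrt ((1 - x 1 ^ 2) * (1 - (1 - m) * x 1 ^ 2))) -
    1 / Real.sqrt ((1 - x 0 ^ 2) * (1 - m * x 0 ^ 2)) *
      (1 / Real.sqrt ((1 - x 1 ^ 2) * (1 - (1 - m) * x 1 ^ 2)))

/-- **M1 re-check**: `f_k − F_{k²} = h(x₀,x₁) − h(x₁,x₀)`, `h(a,b) = e_{1−k²}(a) κ_{k²}(b)`, as a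
ring identity valid for ALL `x` (no domain condition). [folklore] -/
theorem symmetrise_pointwise (k : ℝ) (x : Fin 2 → ℝ) :
    cruxIntegrandAt k x - symIntegrand (k ^ 2) x =
      Real.sqrt (1 - (1 - k ^ 2) * x 0 ^ 2) / Real.sqrt (1 - x 0 ^ 2) /
          Real.sqrt ((1 - x 1 ^ 2) * (1 - k ^ 2 * x 1 ^ 2)) -
        Real.sqrt (1 - (1 - k ^ 2) * x 1 ^ 2) / Real.sqrt (1 - x 1 ^ 2) /
          Real.sqrt ((1 - x 0 ^ 2) * (1 - k ^ 2 * x 0 ^ 2)) := by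
  simp only [cruxIntegrandAt, symIntegrand]
  ring

/-- The two radicands of `Φ_m` are positive on the open square for `0 ≤ m ≤ 1`. [folklore] -/
theorem radicands_pos (hm0 : 0 ≤ m) (hm1 : m ≤ 1) (hx : x ∈ unitSq) :
    0 < 1 - m * x 0 ^ 2 ∧ 0 < 1 - (1 - m) * x 1 ^ 2 := by
  have h0 := one_sub_sq_pos (hx 0)
  have h1 := one_sub_sq_pos (hx 1)
  constructor
  · nlinarith [mul_nonneg hm0 (sq_nonneg (x 0)), mul_nonneg (sub_nonneg.2 hm1) (sq_nonneg (x 0))]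
  · nlinarith [mul_nonneg hm0 (sq_nonneg (x 1)), mul_nonneg (sub_nonneg.2 hm1) (sq_nonneg (x 1))]

/-- **M2 (i)**: `1 − X² − Z² = (1 − x₀²)(1 − x₁²)` along `Φ_m`. [folklore] -/
theorem one_sub_normSq_spheroConal (hm0 : 0 ≤ m) (hm1 : m ≤ 1) (hx : x ∈ unitSq) :
    1 - spheroConal m x 0 ^ 2 - spheroConal m x 1 ^ 2 = (1 - x 0 ^ 2) * (1 - x 1 ^ 2) := by
  obtain ⟨hB, hD⟩ := radicands_pos hm0 hm1 hx
  simp only [spheroConal, Matrix.cons_val_zero, Matrix.cons_val_one, mul_pow,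
    Real.sq_sqrt hB.le, Real.sq_sqrt hD.le]
  ring

/-- **M2 (ii)**: `det DΦ_m > 0` on the open square (`1 − m x₀² − (1−m)x₁² = m(1−x₀²) + (1−m)(1−x₁²)`). [folklore] -/
theorem spheroConalDet_pos (hm0 : 0 ≤ m) (hm1 : m ≤ 1) (hx : x ∈ unitSq) :
    0 < spheroConalDet m x := by
  obtain ⟨hB, hD⟩ := radicands_pos hm0 hm1 hx
  have h0 := one_sub_sq_pos (hx 0)
  have h1 := one_sub_sq_pos (hx 1)
  have hnum : 0 < 1 - m * x 0 ^ 2 - (1 - m) * x 1 ^ 2 := by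
    have : 1 - m * x 0 ^ 2 - (1 - m) * x 1 ^ 2 = m * (1 - x 0 ^ 2) + (1 - m) * (1 - x 1 ^ 2) := by
      ring
    rw [this]
    rcases eq_or_lt_of_le hm0 with h | h
    · rw [← h]
      nlinarith
    · nlinarith [mul_nonneg (sub_nonneg.2 hm1) h1.le]
  exact div_pos hnum (mul_pos (Real.sqrt_pos.2 hB) (Real.sqrt_pos.2 hD))

/-- **M2 (iii)**: `Φ_m` maps the open square into the open quarter disc
`Q = {X > 0, Z > 0, X² + Z² < 1}`. [folklore] -/
theorem spheroConal_mem_quarterDisc (hm0 : 0 ≤ m) (hm1 : m ≤ 1) (hx : x ∈ unitSq) :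
    0 < spheroConal m x 0 ∧ 0 < spheroConal m x 1 ∧
      spheroConal m x 0 ^ 2 + spheroConal m x 1 ^ 2 < 1 := by
  obtain ⟨hB, hD⟩ := radicands_pos hm0 hm1 hx
  have h0 := one_sub_sq_pos (hx 0)
  have h1 := one_sub_sq_pos (hx 1)
  have hsum := one_sub_normSq_spheroConal hm0 hm1 hx
  refine ⟨?_, ?_, ?_⟩
  · simp only [spheroConal, Matrix.cons_val_zero]
    exact mul_pos (hx 0).1 (Real.sqrt_pos.2 hD)
  · simp only [spheroConal, Matrix.cons_val_one]
    exact mul_pos (hx 1).1 (Real.sqrt_pos.2 hB)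
  · nlinarith [mul_pos h0 h1]

/-- **M2 (iv), THE SPHERO-CONAL IDENTITY in the lead's verbatim shape**: on the open square,
`F_m(x) = (1 − X² − Z²)^{-1/2} · |det DΦ_m(x)|`, `(X,Z) = Φ_m(x)`, for every `0 ≤ m ≤ 1` — i.e.
`F_m dx₀dx₁ = Φ_m^*(dXdZ/√(1 − X² − Z²))`, the area form of the positive octant of `S²` in Jacobi's
sphero-conal coordinates; exactly the integrand equation of the rule-(2) move of `stub_octantTransfer`.
[folklore] -/
theorem octant_pointwise (hm0 : 0 ≤ m) (hm1 : m ≤ 1) (hx : x ∈ unitSq) :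
    symIntegrand m x =
      1 / Real.sqrt (1 - spheroConal m x 0 ^ 2 - spheroConal m x 1 ^ 2) * |spheroConalDet m x| := by
  rw [one_sub_normSq_spheroConal hm0 hm1 hx, abs_of_pos (spheroConalDet_pos hm0 hm1 hx)]
  obtain ⟨hB, hD⟩ := radicands_pos hm0 hm1 hx
  have hA := one_sub_sq_pos (hx 0)
  have hC := one_sub_sq_pos (hx 1)
  simp only [symIntegrand, spheroConalDet]
  rw [Real.sqrt_mul hA.le (1 - m * x 0 ^ 2), Real.sqrt_mul hC.le (1 - (1 - m) * x 1 ^ 2),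
    Real.sqrt_mul hA.le (1 - x 1 ^ 2)]
  have hb2 : Real.sqrt (1 - m * x 0 ^ 2) ^ 2 = 1 - m * x 0 ^ 2 := Real.sq_sqrt hB.le
  have hd2 : Real.sqrt (1 - (1 - m) * x 1 ^ 2) ^ 2 = 1 - (1 - m) * x 1 ^ 2 := Real.sq_sqrt hD.le
  have key : 1 - m * x 0 ^ 2 - (1 - m) * x 1 ^ 2 =
      Real.sqrt (1 - m * x 0 ^ 2) ^ 2 + Real.sqrt (1 - (1 - m) * x 1 ^ 2) ^ 2 - 1 := by
    rw [hb2, hd2]; ring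
  rw [key]
  set a := Real.sqrt (1 - x 0 ^ 2) with ha_def
  set b := Real.sqrt (1 - m * x 0 ^ 2) with hb_def
  set c := Real.sqrt (1 - x 1 ^ 2) with hc_def
  set d := Real.sqrt (1 - (1 - m) * x 1 ^ 2) with hd_def
  have ha : a ≠ 0 := (Real.sqrt_pos.2 hA).ne'
  have hb : b ≠ 0 := (Real.sqrt_pos.2 hB).ne'
  have hc : c ≠ 0 := (Real.sqrt_pos.2 hC).ne'
  have hd : d ≠ 0 := (Real.sqrt_pos.2 hD).ne'
  field_simp
  ring

/-- **M3, the strip density identity**: with `X = s√(1−y²)/√(1+s²)` (`s > 0`, `0 < y < 1`),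
`(1 − X² − y²)^{-1/2} · (√(1−y²)/√(1+s²)³) = 1/(1+s²)` — the integrand equation of the rule-(2)
move of `stub_discToStrip` (Jacobian `∂X/∂s = √(1−y²)(1+s²)^{-3/2}`). [folklore] -/
theorem strip_pointwise {s y : ℝ} (hs : 0 < s) (hy : y ∈ Ioo (0:ℝ) 1) :
    1 / Real.sqrt (1 - (s * Real.sqrt (1 - y ^ 2) / Real.sqrt (1 + s ^ 2)) ^ 2 - y ^ 2) *
        (Real.sqrt (1 - y ^ 2) / Real.sqrt (1 + s ^ 2) ^ 3) = 1 / (1 + s ^ 2) := by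
  have hy2 : 0 < 1 - y ^ 2 := one_sub_sq_pos hy
  have hs2 : 0 < 1 + s ^ 2 := by positivity
  have hc2 : Real.sqrt (1 - y ^ 2) ^ 2 = 1 - y ^ 2 := Real.sq_sqrt hy2.le
  have hq2 : Real.sqrt (1 + s ^ 2) ^ 2 = 1 + s ^ 2 := Real.sq_sqrt hs2.le
  have hcpos : 0 < Real.sqrt (1 - y ^ 2) := Real.sqrt_pos.2 hy2
  have hqpos : 0 < Real.sqrt (1 + s ^ 2) := Real.sqrt_pos.2 hs2
  have key : 1 - (s * Real.sqrt (1 - y ^ 2) / Real.sqrt (1 + s ^ 2)) ^ 2 - y ^ 2 =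
      (Real.sqrt (1 - y ^ 2) / Real.sqrt (1 + s ^ 2)) ^ 2 := by
    rw [div_pow, div_pow, mul_pow, hc2, hq2]
    field_simp
    ring
  rw [key, Real.sqrt_sq (div_pos hcpos hqpos).le]
  set c := Real.sqrt (1 - y ^ 2) with hc_def
  set q := Real.sqrt (1 + s ^ 2) with hq_def
  rw [← hq2]
  field_simp

end LineSketch

end Summit.KontsevichZagierPeriods.KontsevichZagierPeriods.Cruxes.LegendreAllModuli.Disproof
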